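import Mathlib.NumberTheory.Padics.Complex
import Mathlib.Topology.Algebra.Group.Quotient
import Literature.NumberTheory.GaloisRepresentations.GaloisRep
import HarnessLib

/-!
# Tate's lifting theorem for projective `ℓ`-adic Galois representations (Tate; Conrad; Patrikis)

A NAMED FACT (D-0014, statement only) on the carriers of `GaloisRep.lean`
(`FramedGaloisRep F (PadicAlgCl ℓ) n = Γ_F →ₜ* GL_n(ℚ̄_ℓ)`, `FramedGaloisRep.IsUnramifiedAt`):

* `Patrikis2019_exists_lift_projective` — for a number field `F`, a prime `ℓ` and a continuous
  homomorphism `r : Γ_F → PGL_n(ℚ̄_ℓ)`, there is a continuous lift `W : Γ_F → GL_n(ℚ̄_ℓ)` of `r`;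
  if `r` is unramified at all but finitely many finite places, `W` may be chosen so too.

## Source

S. Patrikis, *Variations on a theorem of Tate*, Mem. AMS 1238 (2019) (arXiv:1207.6724, held text),
§2.1 "Review of lifting results": Tate's theorem (Thm. 4 of Serre's survey) "Let `F` be a number
field. Then `H²(Γ_F, ℚ/ℤ) = 0`", and the Proposition following it (= B. Conrad, *Lifting global
representations with local properties*, Prop. 5.3): "Let `H' ↠ H` be a surjection of linear
algebraic groups over `ℚ̄_ℓ` with kernel a central torus `S^∨`. Then any continuous representation
`ρ : Γ_F → H(ℚ̄_ℓ)` lifts to `H'(ℚ̄_ℓ)`", with the Remark after it: "If `ρ` is almost everywhere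
unramified, then it is easy to see that `ρ̃` is almost everywhere unramified; see Lemma 5.2 of
[Conrad]" (and: "in the case of `GL_n → PGL_n`, this proof produces lifts with finite-order
determinant"). VENDORED: the instance `H' = GL_n ↠ H = PGL_n` (kernel `𝔾_m`, a central torus —
"The simplest example is `SL_n ⊂ GL_n`" in the proof), i.e. the `ℓ`-adic form of Tate's lifting
theorem for projective representations.

## Rendering

* `ℚ̄_ℓ` is Mathlib's `PadicAlgCl ℓ` (the convention of `GaloisRep.lean`); `PGL_n(ℚ̄_ℓ)` is the
  topological group `GL (Fin n) (PadicAlgCl ℓ) ⧸ Subgroup.center _` with the QUOTIENT topology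
  (`ℚ̄_ℓ` is algebraically closed, so `GL_n(ℚ̄_ℓ) → PGL_n(ℚ̄_ℓ)` is onto the `ℚ̄_ℓ`-points of the
  algebraic group `PGL_n`; the `𝔾_m`-torsor `GL_n → PGL_n` has algebraic local sections
  (`A ↦ A / a_{ij}` on `{a_{ij} ≠ 0}`), so the quotient topology is the `ℓ`-adic topology of
  `PGL_n(ℚ̄_ℓ) ⊂ GL_{n²}(ℚ̄_ℓ)`), and a projective representation is a continuous homomorphism
  `r : Γ_F →ₜ* GL_n(ℚ̄_ℓ) ⧸ center`; "lift" means `mk ∘ W = r` pointwise.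
* "unramified at `v`" for `r` is spelled as for `FramedGaloisRep.IsUnramifiedAt`: every inertia
  group at every prime of `ℤ̄_F` above `v` maps to `1`; "almost everywhere" is
  `∀ᶠ v in Filter.cofinite`.
* NOT vendored: the general central-torus statement for arbitrary linear algebraic groups `H' ↠ H`
  (no carrier for "linear algebraic group over `ℚ̄_ℓ` with its `ℓ`-adic points" in the tree), the
  finite-order-determinant refinement, and the geometric (Hodge–Tate / de Rham) refinements of
  Patrikis Ch. 3 (Thm. 3.2.10). The `D₃ = A₃` consequence used by route
  Langlands/K3KugaSatakeDescent (an `SO_6(ℚ̄_ℓ)`-valued `r` admits `W : Γ_F → GL_4(ℚ̄_ℓ)` and a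
  character `ν` with `Λ²W ≅ ν ⊗ r`) is this fact at `n = 4` composed with the exceptional isogeny
  `Λ² : GL_4 → GSO_6` (`SO_6 ≅ SL_4/μ_2`, `PSO_6 ≅ PGL_4`), algebra which is not in the tree.

## References

* [Patrikis2019] S. Patrikis, Variations on a theorem of Tate, Mem. Amer. Math. Soc. 258 (2019),
  no. 1238, §2.1 (Tate's theorem; the Proposition = Conrad Prop. 5.3; the Remark = Conrad Lemma 5.2).
* B. Conrad, Lifting global representations with local properties, preprint (2011), Prop. 5.3,
  Lemma 5.2.
* J.-P. Serre, Modular forms of weight one and Galois representations (Durham survey, 1977), Thm. 4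
  (Tate: `H²(Γ_F, ℚ/ℤ) = 0`).
-/

noncomputable section

open scoped NumberField
open IsDedekindDomain

namespace Literature.NumberTheory.GaloisRepresentations

/-- **Tate's lifting theorem, `ℓ`-adic form (Tate; Conrad, Prop. 5.3 and Lemma 5.2; Patrikis 2019,
§2.1).** For a number field `F`, a prime `ℓ`, `n : ℕ`, and a continuous homomorphism
`r : Γ_F → PGL_n(ℚ̄_ℓ) = GL_n(ℚ̄_ℓ) ⧸ center` (quotient topology):
(i) there is a continuous `W : Γ_F → GL_n(ℚ̄_ℓ)` lifting `r` ("any continuous representation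
`ρ : Γ_F → H(ℚ̄_ℓ)` lifts to `H'(ℚ̄_ℓ)`" for `H' ↠ H` with central torus kernel, here
`GL_n ↠ PGL_n`, resting on Tate's `H²(Γ_F, ℚ/ℤ) = 0`); (ii) if `r` is unramified at all but
finitely many finite places of `F` (every inertia group above such a place dies), then such a lift
`W` exists which is moreover unramified at all but finitely many finite places ("If `ρ` is almost
everywhere unramified, then … `ρ̃` is almost everywhere unramified"). [cite: Patrikis2019, §2.1 (Tate's theorem, the Proposition = Conrad Prop. 5.3, and the Remark following it)] -/
def Patrikis2019_exists_lift_projective : Prop :=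
  ∀ (F : Type) [Field F] [NumberField F] (ℓ n : ℕ) [Fact ℓ.Prime]
    (r : Field.absoluteGaloisGroup F →ₜ*
      (GL (Fin n) (PadicAlgCl ℓ) ⧸ Subgroup.center (GL (Fin n) (PadicAlgCl ℓ)))),
    (∃ W : FramedGaloisRep F (PadicAlgCl ℓ) n,
        ∀ σ, (QuotientGroup.mk (W σ) : GL (Fin n) (PadicAlgCl ℓ) ⧸ Subgroup.center _) = r σ) ∧
      ((∀ᶠ v : HeightOneSpectrum (𝓞 F) in Filter.cofinite,
          ∀ 𝔓 ∈ v.primesAbove, ∀ σ ∈ 𝔓.inertia (Field.absoluteGaloisGroup F), r σ = 1) →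
        ∃ W : FramedGaloisRep F (PadicAlgCl ℓ) n,
          (∀ σ, (QuotientGroup.mk (W σ) : GL (Fin n) (PadicAlgCl ℓ) ⧸ Subgroup.center _) = r σ) ∧
            ∀ᶠ v : HeightOneSpectrum (𝓞 F) in Filter.cofinite, W.IsUnramifiedAt v)

/-- Unfolding lemma. [folklore] -/
theorem Patrikis2019_exists_lift_projective_iff :
    Patrikis2019_exists_lift_projective ↔
      ∀ (F : Type) [Field F] [NumberField F] (ℓ n : ℕ) [Fact ℓ.Prime]
        (r : Field.absoluteGaloisGroup F →ₜ*
          (GL (Fin n) (PadicAlgCl ℓ) ⧸ Subgroup.center (GL (Fin n) (PadicAlgCl ℓ)))),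
        (∃ W : FramedGaloisRep F (PadicAlgCl ℓ) n,
            ∀ σ, (QuotientGroup.mk (W σ) : GL (Fin n) (PadicAlgCl ℓ) ⧸ Subgroup.center _) = r σ) ∧
          ((∀ᶠ v : HeightOneSpectrum (𝓞 F) in Filter.cofinite,
              ∀ 𝔓 ∈ v.primesAbove, ∀ σ ∈ 𝔓.inertia (Field.absoluteGaloisGroup F), r σ = 1) →
            ∃ W : FramedGaloisRep F (PadicAlgCl ℓ) n,
              (∀ σ, (QuotientGroup.mk (W σ) : GL (Fin n) (PadicAlgCl ℓ) ⧸ Subgroup.center _) = r σ) ∧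
                ∀ᶠ v : HeightOneSpectrum (𝓞 F) in Filter.cofinite, W.IsUnramifiedAt v) :=
  Iff.rfl

/-- **A lift is unramified wherever it is, and then so is the projective representation**: if
`W` lifts `r` and `W` is unramified at `v`, then `r` is unramified at `v` (inertia dies under
`mk ∘ W = r`). The easy converse direction of the Remark; recorded as the sanity check that the
hypothesis of (ii) is necessary for its conclusion. [folklore] -/
theorem isUnramifiedAt_projective_of_lift {F : Type} [Field F] [NumberField F] {ℓ n : ℕ}
    [Fact ℓ.Prime]
    (r : Field.absoluteGaloisGroup F →ₜ*
      (GL (Fin n) (PadicAlgCl ℓ) ⧸ Subgroup.center (GL (Fin n) (PadicAlgCl ℓ))))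
    (W : FramedGaloisRep F (PadicAlgCl ℓ) n)
    (hW : ∀ σ, (QuotientGroup.mk (W σ) : GL (Fin n) (PadicAlgCl ℓ) ⧸ Subgroup.center _) = r σ)
    {v : HeightOneSpectrum (𝓞 F)} (hv : W.IsUnramifiedAt v) :
    ∀ 𝔓 ∈ v.primesAbove, ∀ σ ∈ 𝔓.inertia (Field.absoluteGaloisGroup F), r σ = 1 := by
  intro 𝔓 h𝔓 σ hσ
  rw [← hW σ, hv 𝔓 h𝔓 σ hσ, QuotientGroup.mk_one]

end Literature.NumberTheory.GaloisRepresentations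

end
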